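import Literature.NumberTheory.LFunctions.WeilTwoPrimeOddMarginFBase
import Literature.NumberTheory.LFunctions.WeilTwoPrimeOddMarginFDataDn2
import Literature.NumberTheory.LFunctions.WeilBlockRowsPZ
import HarnessLib

/-!
# Two-prime odd-margin certificate F: the factored inverse agrees with `D`, rows 75–78

`WeilCert.checkDnRow` for rows 75–78 of certificate F, by `decide +kernel`. Pure proof file.
-/

noncomputable section

namespace Literature.NumberTheory.LFunctions

set_option maxHeartbeats 0 in
/-- Row 75 of `Dn/Ls` is row 75 of `D` (certificate F). [folklore] -/
theorem checkDnRow1_75_weilCert23F : weilCert23FBase.checkDnRow weilCert23FDn weilCert23FLs 1 75 = true := by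
  decide +kernel

set_option maxHeartbeats 0 in
/-- Row 76 of `Dn/Ls` is row 76 of `D` (certificate F). [folklore] -/
theorem checkDnRow1_76_weilCert23F : weilCert23FBase.checkDnRow weilCert23FDn weilCert23FLs 1 76 = true := by
  decide +kernel

set_option maxHeartbeats 0 in
/-- Row 77 of `Dn/Ls` is row 77 of `D` (certificate F). [folklore] -/
theorem checkDnRow1_77_weilCert23F : weilCert23FBase.checkDnRow weilCert23FDn weilCert23FLs 1 77 = true := by
  decide +kernel

set_option maxHeartbeats 0 in
/-- Row 78 of `Dn/Ls` is row 78 of `D` (certificate F). [folklore] -/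
theorem checkDnRow1_78_weilCert23F : weilCert23FBase.checkDnRow weilCert23FDn weilCert23FLs 1 78 = true := by
  decide +kernel


end Literature.NumberTheory.LFunctions
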